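/-
TEAM hComp (cell pub-hodgecm2) — seat hcomp-shimura gen 10 (Shimura-datum / canonical-model record side).  STAGED, NOT FILED:
the ADAPTER between pin-1's total carrier `Model.sec42DataOf` (CARRIERS-PLAN S5-DEF, STAGE-ONLY; bytes of record
`pin-1/Sec42DataOf.lean` md5 859348133294, explicit binders) and this seat's bridge `HComp/HeckeTranslatesOfRecord.lean` (S6 bridge
v3, STAGE-ONLY).  Files only after both, on the hcomp-lead's word (lead rule (1): new Summits path ⇒ naming with the filing word).
v2 = v1 698141ddb5ce with the three cited facts `hU7`, `h`, `hA` (and the carriers) as EXPLICIT binders on every declaration instead of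
`variable` lines (lead gen 7 HYGIENE l.4666 (2); positional API unchanged; the filing note discloses it).
v3 (gen 12) = v2 cbab626e1447 re-cut against pin-1's Albanese-FREE S5-DEF v3 `pin-1/Sec42DataOf.v3-albFree.lean` c46747dec027: the
binder/argument `(hA : exists_albanese)` is DROPPED everywhere and nothing else changes (hcomp-lead g3 ruling l.7709 (3) = x2 g8's
kernel-checked candidate X2AV3-0, HOME/INBOX l.7702).  HC_CM is NOT proved.
-/
import Summits.HodgeConjecture.CorCM.B01.Transposition.HComp.Sec42DataOf
import Summits.HodgeConjecture.CorCM.B01.Transposition.HComp.HeckeTranslatesOfRecord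
import HarnessLib

/-!
# Hecke translates on the total §4.2 carrier `Model.sec42DataOf h iso` (CARRIERS-PLAN S5 × S6)

[Liu2021] = Y. Liu, arXiv:2102.11518 (`FJcycle.tex` md5 `6db49a74122d`); [Milne2005ShimuraVarieties] J. S. Milne, *Introduction to
Shimura varieties* (2005).

pin-1's `Model.sec42DataOf h iso F ι₁ V Φ : Sec42Data (honestP5Of h F ι₁ V Φ) (iso F ι₁ V Φ)` (`HComp/Sec42DataOf.lean`) is the
TOTAL §4.2 carrier: `sec42DataOfFourLe h V Φ h4 _ = Sec42Data.ofAlbanese … (honestSystemOf h V Φ) … (compactifiedOf h V Φ h4) alb`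
when `4 ≤ [F:ℚ]` (`sec42DataOf_eq_of_four_le`, a `dif_pos`), a punctured-branch inhabitant otherwise.  This seat's bridge
`Model.sec42HeckeTranslatesOf hU7 h V Φ h4 iso alb` (`HComp/HeckeTranslatesOfRecord.lean`) constructs the Hecke translates
([Milne2005ShimuraVarieties] Def. 12.10 (a) / Thm. 13.6; [Liu2021] §4.2 l. 2074) on EVERY `Sec42Data.ofAlbanese … (compactifiedOf h V Φ h4) alb`
from the cited facts `h` ([Deligne1979ShimuraVarieties] 2.2.5) and `hU7` ([Milne2005ShimuraVarieties] Thm. 13.6).  This file puts the two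
together:

* `sec42DataOfFourLe_heckeTranslates` — translates on the explicit carrier (the bridge at pin-1's `alb`, definitionally);
* `sec42DataOf_heckeTranslates` — translates on the total carrier at `4 ≤ [F:ℚ]`, transported along `sec42DataOf_eq_of_four_le`;
* `heckeTranslatesFamilyOf hU7 h iso : ∀ F ι₁ V Φ, 6 ≤ [F:ℚ] → (sec42DataOf h iso F ι₁ V Φ).HeckeTranslates` — EXACTLY the
  Π-binder `T` of the second-re-cut END display (this seat's socket `…_restOne_hecke_meeting_rec`) at `C := Model.sec42DataOf h iso`:
  with it `T` leaves the display BY APPLICATION (binder −1) and the cite `hU7` enters (cite +1).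

CONDITIONAL on `h`, `hU7` (cited facts, taken as hypotheses; the Albanese data are pin-1's Classical choices from abcm-1's PROVED existence); definitions only; no display is re-cut here; HC_CM is NOT proved.
-/

noncomputable section

open CategoryTheory AlgebraicGeometry NumberField
open Literature.AlgebraicGeometry.Motives
open Literature.AlgebraicGeometry.ShimuraVarieties.UnitaryCanonicalModel
open Literature.NumberTheory.Automorphic
open Literature.NumberTheory.Automorphic.Liu2021
open Literature.NumberTheory.Automorphic.Liu2021.AppendixC
open Summit.HodgeConjecture.CorCM.HComp

namespace Summit.HodgeConjecture.CorCM.Model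

section FourLe

/-- **Hecke translates on the explicit §4.2 carrier `sec42DataOfFourLe h V Φ h4 iso`** (`4 ≤ [F:ℚ]`, Compact Case): the bridge
`sec42HeckeTranslatesOf hU7 h V Φ h4 iso` at pin-1's choice of Albanese data — `T_g : X_K ⟶ X_{K'}` for `g⁻¹Kg ⊆ K'` the base change
along `c` of the record's Hecke translate ([Milne2005ShimuraVarieties] Thm. 13.6 via `hU7`), with the three laws `T_1 = u`,
`T_g ≫ T_{g'} = T_{gg'}`, `T_k = 𝟙 (k ∈ K)` THEOREMS over the record.  CONDITIONAL on `h`, `hU7`.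
[cite: Liu2021, §4.2 l. 2070–2074 and App. C l. 4656] [cite: Milne2005ShimuraVarieties, Def. 12.10 (a) p. 115 and Thm. 13.6 p. 118] -/
def sec42DataOfFourLe_heckeTranslates
    (hU7 : heckeTranslate_definedOver) (h : exists_recordSystem)
    {F : CMField} {ι₁ : F →+* ℂ} (V : HermSpace3 F ι₁) (Φ : Literature.AlgebraicGeometry.Motives.CMType F) (h4 : 4 ≤ Module.finrank ℚ F) (iso : ℕ → Prop) :
    (sec42DataOfFourLe h V Φ h4 iso).HeckeTranslates :=
  sec42HeckeTranslatesOf hU7 h V Φ h4 iso _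

/-- Its translate IS the base-changed record translate (by `rfl`). [cite: Liu2021, Prop. C.5 l. 4627–4633 and App. C l. 4656] -/
theorem sec42DataOfFourLe_heckeTranslates_tr
    (hU7 : heckeTranslate_definedOver) (h : exists_recordSystem)
    {F : CMField} {ι₁ : F →+* ℂ} (V : HermSpace3 F ι₁) (Φ : Literature.AlgebraicGeometry.Motives.CMType F) (h4 : 4 ≤ Module.finrank ℚ F) (iso : ℕ → Prop) (g : ↥V.adelicFin)
    (K K' : C5.SmallLevel (honestSystemOf h V Φ).K₀) (hK : C5.HeckeLE g K K') :
    (sec42DataOfFourLe_heckeTranslates hU7 h V Φ h4 iso).tr g K K' hK =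
      (baseChangeHom (cmConjRingHom F)).map (recordFunctorHeckeTranslate hU7 h V h4 g K K' hK) := rfl

end FourLe

/-- **Hecke translates on the TOTAL carrier `sec42DataOf h iso F ι₁ V Φ` at `4 ≤ [F:ℚ]`**: the explicit ones, transported along
`sec42DataOf_eq_of_four_le` (`dif_pos`).  CONDITIONAL on `h`, `hU7`.
[cite: Liu2021, §4.2 l. 2070–2074] [cite: Milne2005ShimuraVarieties, Thm. 13.6 p. 118] -/
def sec42DataOf_heckeTranslates
    (hU7 : heckeTranslate_definedOver) (h : exists_recordSystem)
    {F : CMField} {ι₁ : F →+* ℂ} (V : HermSpace3 F ι₁) (Φ : Literature.AlgebraicGeometry.Motives.CMType F)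
    (iso : ∀ (F : CMField) (ι₁ : F →+* ℂ) (_ : HermSpace3 F ι₁) (_ : Literature.AlgebraicGeometry.Motives.CMType F), ℕ → Prop)
    (h4 : 4 ≤ Module.finrank ℚ F) : (sec42DataOf h iso F ι₁ V Φ).HeckeTranslates :=
  cast (congrArg (fun C => Sec42Data.HeckeTranslates C) (sec42DataOf_eq_of_four_le h V Φ iso h4).symm)
    (sec42DataOfFourLe_heckeTranslates hU7 h V Φ h4 (iso F ι₁ V Φ))

/-- Transport bookkeeping: along `sec42DataOf_eq_of_four_le` the translates on the total carrier ARE the explicit ones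
(a `cast` along `congrArg HeckeTranslates`; heterogeneous equality `cast_heq` — rewrite a goal with `sec42DataOf_eq_of_four_le` first, then use this). Ours. [cite: Liu2021, §4.2 l. 2070–2074] -/
theorem sec42DataOf_heckeTranslates_heq
    (hU7 : heckeTranslate_definedOver) (h : exists_recordSystem)
    {F : CMField} {ι₁ : F →+* ℂ} (V : HermSpace3 F ι₁) (Φ : Literature.AlgebraicGeometry.Motives.CMType F)
    (iso : ∀ (F : CMField) (ι₁ : F →+* ℂ) (_ : HermSpace3 F ι₁) (_ : Literature.AlgebraicGeometry.Motives.CMType F), ℕ → Prop)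
    (h4 : 4 ≤ Module.finrank ℚ F) :
    HEq (sec42DataOf_heckeTranslates hU7 h V Φ iso h4)
      (sec42DataOfFourLe_heckeTranslates hU7 h V Φ h4 (iso F ι₁ V Φ)) :=
  cast_heq _ _

/-- **`heckeTranslatesFamilyOf hU7 h iso`** — the Hecke translates as the Π-family `∀ F ι₁ V Φ, 6 ≤ [F:ℚ] →
(sec42DataOf h iso F ι₁ V Φ).HeckeTranslates`: EXACTLY the binder `T` of the Hecke-layer END displays at `C := Model.sec42DataOf h iso`
(CARRIERS-PLAN S6 → S7; `6 ≤ [F:ℚ]` ⇒ `4 ≤ [F:ℚ]`; = x2's X2AV3-0).  CONDITIONAL on `h`, `hU7`; instantiating `T` at this term is the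
S7 consumer's act, not done here; HC_CM is NOT proved. [cite: Liu2021, §4.2 l. 2070–2074, Def. 4.16 l. 2219] [cite: Milne2005ShimuraVarieties, Thm. 13.6 p. 118] -/
def heckeTranslatesFamilyOf (hU7 : heckeTranslate_definedOver) (h : exists_recordSystem)
    (iso : ∀ (F : CMField) (ι₁ : F →+* ℂ) (_ : HermSpace3 F ι₁) (_ : Literature.AlgebraicGeometry.Motives.CMType F), ℕ → Prop) :
    ∀ (F : CMField) (ι₁ : F →+* ℂ) (V : HermSpace3 F ι₁) (Φ : Literature.AlgebraicGeometry.Motives.CMType F),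
      6 ≤ Module.finrank ℚ F → (sec42DataOf h iso F ι₁ V Φ).HeckeTranslates :=
  fun _ _ V Φ h6 => sec42DataOf_heckeTranslates hU7 h V Φ iso (le_trans (by norm_num) h6)

end Summit.HodgeConjecture.CorCM.Model

end
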